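/-
Copyright (c) 2026. All rights reserved.
Released under Apache 2.0 license as described in the file LICENSE.
Authors: abc-iut cell, prover seat abc-iut-c312-5 (Cor. 3.12 sub-crew, gen 7).
-/
import Literature.IUT.LogVolume.UnitLogDyadicSqrtNegOne
import Literature.IUT.LogVolume.UnitLogDyadicPowerCriterion
import Literature.IUT.LogVolume.UnitLogKernel
import HarnessLib

/-!
# Totally ramified quartic dyadic fields without `√−1`: NO ball is a `2^k · log₂(𝒪_K^×)` — the dyadic table closes

Proof-only file (theorems, no definitions).  Classical `2`-adic analysis (Neukirch, *Algebraic Number Theory*,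
Ch. II (5.5), (5.7)); nothing here is disputed mathematics and no IUT statement is asserted.

Let `K` be a complete ultrametric normed `ℚ₂`-algebra field, `ϖ` a uniformizer, `e`, `f` its absolute
ramification index and residue degree, `2^m = #μ_{2^∞}(K)` (`torsionPExp`).  abc-iut-w4-d017's
`UnitLogDyadicNoFixedBall` / `UnitLogDyadicSqrtNegOne` decide, for every dyadic local type except ONE, whether some
ball `{‖y‖ ≤ ‖ϖ‖^j}` is a `2^k · log₂(𝒪_K^×)`; the type left open there is `(e, f) = (4, 1)` with `m = 1`
(`μ_{2^∞}(K) = {±1}`, i.e. `√−1 ∉ K`; e.g. `ℚ₂(2^{1/4})`, `ℚ₂(3^{1/4})`, `π⁴ + 2π² + 6 = 0`), where the behaviour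
of `log₂` on the FIRST unit filtration step is genuinely field-dependent (abc-iut-S1's `UnitLogWildDyadicQuarticPair`,
abc-iut-w5-d017's `UnitLogDyadicQuarticFields`).  This file settles it UNIFORMLY, by a structural argument that
never looks at the first filtration step:

* §1 `eq_one_or_eq_neg_one_of_pow_eq_one` — `f = 1`, `m = 1` ⇒ the roots of unity of `K` are `±1`
  (`#R^μ = 2^m·(2^f − 1) = 2`, abc-iut-S1's `card_torsionUnits`);
* §2 **SQUARES LEMMA** `norm_sq_sub_one_le_of_lt` — `e = 4`, every unit principal (`f = 1`): for a unit `u`,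
  `‖u² − 1‖ < ‖ϖ‖⁶ ⇒ ‖u² − 1‖ ≤ ‖ϖ‖⁹` (with `u = 1 + x`, `u² − 1 = x·(x + 2)`: `‖x‖ > ‖2‖ = ‖ϖ‖⁴` gives
  `‖x‖² ≥ ‖ϖ‖⁶`; `‖x‖ < ‖2‖` gives `‖x‖·‖2‖ ≤ ‖ϖ‖⁹`; `‖x‖ = ‖2‖` gives `x + 2 = 2·(1 + x/2)` with the UNIT `x/2`
  principal, so `‖1 + x/2‖ ≤ ‖ϖ‖` and again `≤ ‖ϖ‖⁹`) — so `v(u² − 1) ∉ {7, 8}`;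
* §3 `eq_sq_or_eq_neg_sq_of_logUnits_eq_closedBall_two` — IF `log₂(𝒪_K^×) = 𝔪² = {‖y‖ ≤ ‖ϖ‖²}` (`e = 4`, `f = 1`,
  `m = 1`), then every `w` with `‖1 − w‖ = ‖ϖ‖^a`, `a ≥ 6`, is `± u²` for a unit `u`: `‖log₂ w‖ = ‖ϖ‖^a`
  (isometry range, abc-iut-w5-d017's `norm_logSeries_of_deep`), so `log₂ w / 2 ∈ 𝔪² = log₂(𝒪^×)`, `log₂ w =
  log₂ u²`, and `w/u²` lies in the kernel `R^μ = {±1}` (abc-iut-S1's `unitLog_eq_zero_iff`);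
* §4 **`closedBall_ne_zpow_smul_logUnits_of_absRamificationIdx_eq_four_of_torsionPExp_eq_one`** — `e = 4`,
  `f = 1`, `m = 1` ⇒ `{‖y‖ ≤ ‖ϖ‖^j} ≠ 2^k · log₂(𝒪_K^×)` for ALL `j`, `k`: abc-iut-w5-d039's volume identity
  `m = f·(j − k·e − 1)` (`torsionPExp_eq_of_closedBall_eq_zpow_smul_logUnits`) forces `j = 4k + 2`, i.e.
  `log₂(𝒪_K^×) = 𝔪²`; then `w₁ = 1 − ϖ⁷` and `w₂ = 1 − ϖ⁸` are `± squares` by §3, not squares by §2, hence both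
  MINUS squares, and `u₁²·u₂² = w₁·w₂` has `‖u₁²u₂² − 1‖ = ‖ϖ‖⁷` — contradicting §2;
* §5 the table: **`closedBall_ne_zpow_smul_logUnits_of_absRamificationIdx_eq_four_all`** (`e = 4`, any `f`, any `m`
  ⇒ no ball), **`closedBall_ne_zpow_smul_logUnits_dyadic_complete`** (`e ≥ 2`, `(e, f) ≠ (2, 1)` ⇒ no ball) and
  its norm form.  With abc-iut-w5-d216 (`e = f = 1`: every ball), abc-iut-w5-d180 (`e = 1`, `f ≥ 2`: none) and
  abc-iut-w4-d017's `(2, 1)` trichotomy, the dyadic column of the cell's ball-mover census is now COMPLETE: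
  over `2`, some ball is a `2^k · log₂(𝒪_K^×)` only if `K = ℚ₂` or `(e, f) = (2, 1)`.

Consumer: the abc-iut cell's TEAM R «ismDH mover» thread (`Summits/ABC/IUTFork/Thm311RealIsmDHMoverCriterion`).
Nothing here bears on the disputed [IUTchIII] Cor. 3.12. [cite: NeukirchANT1999, Ch. II Prop. (5.5), (5.7)]
-/

noncomputable section

open Metric Set
open scoped Pointwise

namespace Literature.IUT.LogVolume

namespace DyadicNoFixedBall

open RamificationCriterion Literature.NumberTheory.GaloisRepresentations.Ultrametric

variable {K : Type*} [NontriviallyNormedField K] [instK : NormedAlgebra ℚ_[2] K] [IsUltrametricDist K]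
  [ProperSpace K]

/-! ## 1. `f = 1`, `m = 1`: the roots of unity of `K` are `±1` -/

/-- `p = 2`, `f = 1`, `m = 1` ⇒ `#R^μ = 2^m·(2^f − 1) = 2`. [cite: NeukirchANT1999, Ch. II Prop. (5.7)] -/
theorem card_torsionUnits_eq_two (hf : residueDegree 2 K = 1) (hm : torsionPExp 2 K = 1) :
    Nat.card (torsionUnits K) = 2 := by
  rw [card_torsionUnits 2 K, hm, hf]
  norm_num

/-- **`f = 1`, `m = 1` ⇒ every root of unity of `K` is `±1`** (`R^μ` has two elements, and `1 ≠ −1` in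
characteristic `0`). [cite: NeukirchANT1999, Ch. II Prop. (5.7)] -/
theorem eq_one_or_eq_neg_one_of_pow_eq_one (hf : residueDegree 2 K = 1) (hm : torsionPExp 2 K = 1)
    {ζ : K} {n : ℕ} (hn : 0 < n) (hζ : ζ ^ n = 1) : ζ = 1 ∨ ζ = -1 := by
  classical
  haveI := Literature.NumberTheory.Transcendental.IwasawaLog.charZero 2 (F := K)
  by_cases hζ1 : ζ = 1
  · exact Or.inl hζ1
  right
  have hζ0 : ζ ≠ 0 := by
    rintro rfl
    rw [zero_pow hn.ne'] at hζ
    exact zero_ne_one hζ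
  have hz : Units.mk0 ζ hζ0 ∈ torsionUnits K :=
    (mem_torsionUnits_iff K _).2 ⟨n, hn, by rw [Units.val_mk0, hζ]⟩
  have hneg : (-1 : Kˣ) ∈ torsionUnits K :=
    (mem_torsionUnits_iff K _).2 ⟨2, two_pos, by push_cast; norm_num⟩
  obtain ⟨y, -, hy⟩ := (Nat.card_eq_two_iff' (⟨1, one_mem _⟩ : torsionUnits K)).mp
    (card_torsionUnits_eq_two hf hm)
  have e1 : (⟨Units.mk0 ζ hζ0, hz⟩ : torsionUnits K) = y := hy _ fun h ↦ hζ1 <| by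
    rw [Subtype.mk.injEq] at h
    have h' := congrArg Units.val h
    rwa [Units.val_mk0, Units.val_one] at h'
  have e2 : (⟨-1, hneg⟩ : torsionUnits K) = y := hy _ fun h ↦ by
    rw [Subtype.mk.injEq] at h
    have h' := congrArg Units.val h
    rw [Units.val_neg, Units.val_one] at h'
    have h2 : (2 : K) = 0 := by linear_combination -h'
    exact two_ne_zero h2
  have h := e1.trans e2.symm
  rw [Subtype.mk.injEq] at h
  have h' := congrArg Units.val h
  rwa [Units.val_mk0, Units.val_neg, Units.val_one] at h'

/-! ## 2. The squares lemma at `e = 4`: `v(u² − 1) ∉ {7, 8}` -/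

omit instK [IsUltrametricDist K] [ProperSpace K] in
/-- Discreteness: `‖z‖ < ‖ϖ‖^k ⇒ ‖z‖ ≤ ‖ϖ‖^{k+1}`. [cite: NeukirchANT1999, Ch. II Prop. (5.5)] -/
private theorem norm_le_zpow_succ_of_norm_lt {ϖ : Kˣ} (hϖ : IsUniformizer ϖ) {z : K} {k : ℤ}
    (hz : ‖z‖ < ‖(ϖ : K)‖ ^ k) : ‖z‖ ≤ ‖(ϖ : K)‖ ^ (k + 1) := by
  have hρ0 : 0 < ‖(ϖ : K)‖ := norm_units_pos ϖ
  by_cases hz0 : z = 0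
  · rw [hz0, norm_zero]; exact (zpow_pos hρ0 _).le
  obtain ⟨t, ht⟩ := hϖ.2 (Units.mk0 z hz0)
  rw [Units.val_mk0] at ht
  rw [ht] at hz ⊢
  have hkt : k < t := (zpow_lt_zpow_iff_right_of_lt_one₀ hρ0 hϖ.1).mp hz
  exact zpow_le_zpow_right_of_le_one₀ hρ0 hϖ.1.le (by omega)


/-- **SQUARES LEMMA** (`e = 4`, every unit principal): for a unit `u`, `‖u² − 1‖ < ‖ϖ‖⁶ ⇒ ‖u² − 1‖ ≤ ‖ϖ‖⁹`.
With `x = u − 1` (`‖x‖ < 1`), `u² − 1 = x·(x + 2)` and `‖2‖ = ‖ϖ‖⁴`: if `‖x‖ > ‖2‖` then `‖x‖ ≥ ‖ϖ‖³` and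
`‖u² − 1‖ = ‖x‖² ≥ ‖ϖ‖⁶`; if `‖x‖ < ‖2‖` then `‖x‖ ≤ ‖ϖ‖⁵` and `‖u² − 1‖ = ‖x‖·‖2‖ ≤ ‖ϖ‖⁹`; if `‖x‖ = ‖2‖`
then `x/2` is a unit, hence principal, so `‖1 + x/2‖ = ‖(x/2 − 1) + 2‖ < 1`, `≤ ‖ϖ‖`, and
`‖u² − 1‖ = ‖x‖·‖2‖·‖1 + x/2‖ ≤ ‖ϖ‖⁹`. [cite: NeukirchANT1999, Ch. II Prop. (5.5)] -/
theorem norm_sq_sub_one_le_of_lt {ϖ : Kˣ} (hϖ : IsUniformizer ϖ) (he : absRamificationIdx 2 K = 4)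
    (hprinc : ∀ u : K, ‖u‖ = 1 → IsPrincipal u) {u : K} (hu : ‖u‖ = 1)
    (hlt : ‖u ^ 2 - 1‖ < ‖(ϖ : K)‖ ^ (6 : ℤ)) : ‖u ^ 2 - 1‖ ≤ ‖(ϖ : K)‖ ^ (9 : ℤ) := by
  have hρ0 : 0 < ‖(ϖ : K)‖ := norm_units_pos ϖ
  have hρ1 : ‖(ϖ : K)‖ < 1 := hϖ.1
  have h2 : ‖(2 : K)‖ = ‖(ϖ : K)‖ ^ (4 : ℤ) := by
    rw [norm_two_eq_zpow hϖ, he]; norm_num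
  have h20 : (2 : K) ≠ 0 := norm_pos_iff.mp (by rw [h2]; exact zpow_pos hρ0 _)
  set x : K := u - 1 with hxdef
  have hx1 : ‖x‖ < 1 := by
    rw [hxdef, ← norm_neg, neg_sub]
    exact hprinc u hu
  have hfac : u ^ 2 - 1 = x * (x + 2) := by rw [hxdef]; ring
  rw [hfac, norm_mul] at hlt ⊢
  rcases lt_trichotomy ‖x‖ (‖(ϖ : K)‖ ^ (4 : ℤ)) with hlt4 | heq4 | hgt4
  · -- `‖x‖ < ‖2‖`: `‖x‖ ≤ ‖ϖ‖⁵`, `‖x + 2‖ = ‖2‖`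
    have hx5 : ‖x‖ ≤ ‖(ϖ : K)‖ ^ ((4 : ℤ) + 1) :=
      norm_le_zpow_succ_of_norm_lt hϖ hlt4
    have hx2 : ‖x + 2‖ = ‖(ϖ : K)‖ ^ (4 : ℤ) := by
      have hne : ‖x‖ ≠ ‖(2 : K)‖ := by rw [h2]; exact hlt4.ne
      rw [IsUltrametricDist.norm_add_eq_max_of_norm_ne_norm hne, h2, max_eq_right hlt4.le]
    rw [hx2]
    calc ‖x‖ * ‖(ϖ : K)‖ ^ (4 : ℤ) ≤ ‖(ϖ : K)‖ ^ ((4 : ℤ) + 1) * ‖(ϖ : K)‖ ^ (4 : ℤ) :=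
          mul_le_mul_of_nonneg_right hx5 (zpow_pos hρ0 _).le
      _ = ‖(ϖ : K)‖ ^ (9 : ℤ) := by rw [← zpow_add₀ hρ0.ne']; norm_num
  · -- `‖x‖ = ‖2‖`: `x + 2 = 2·(1 + x/2)` with `x/2` a principal unit
    have hx2u : ‖x / 2‖ = 1 := by rw [norm_div, heq4, h2, div_self (zpow_pos hρ0 _).ne']
    have hP : IsPrincipal (x / 2) := hprinc _ hx2u
    have hlt1 : ‖1 + x / 2‖ < 1 := by
      have h := IsUltrametricDist.norm_add_le_max (-(1 - x / 2)) (2 : K)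
      rw [show -(1 - x / 2) + (2 : K) = 1 + x / 2 by ring, norm_neg] at h
      refine h.trans_lt (max_lt hP ?_)
      rw [h2]; exact zpow_lt_one₀ hρ0 hρ1 (by norm_num)
    have hle1 : ‖1 + x / 2‖ ≤ ‖(ϖ : K)‖ := hϖ.norm_le_of_norm_lt_one _ hlt1
    have hx2 : x + 2 = 2 * (1 + x / 2) := by rw [mul_add, mul_one, mul_div_cancel₀ x h20, add_comm]
    rw [hx2, norm_mul, heq4, h2]
    calc ‖(ϖ : K)‖ ^ (4 : ℤ) * (‖(ϖ : K)‖ ^ (4 : ℤ) * ‖1 + x / 2‖)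
        ≤ ‖(ϖ : K)‖ ^ (4 : ℤ) * (‖(ϖ : K)‖ ^ (4 : ℤ) * ‖(ϖ : K)‖) := by gcongr
      _ = ‖(ϖ : K)‖ ^ (9 : ℤ) := by
          rw [← zpow_add_one₀ hρ0.ne', ← zpow_add₀ hρ0.ne']; norm_num
  · -- `‖x‖ > ‖2‖`: `‖x‖ ≥ ‖ϖ‖³` and `‖x + 2‖ = ‖x‖`, so `‖x·(x+2)‖ ≥ ‖ϖ‖⁶` — excluded by `hlt`
    exfalso
    have hx2 : ‖x + 2‖ = ‖x‖ := by
      have hne : ‖x‖ ≠ ‖(2 : K)‖ := by rw [h2]; exact hgt4.ne'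
      rw [IsUltrametricDist.norm_add_eq_max_of_norm_ne_norm hne, h2, max_eq_left hgt4.le]
    rw [hx2] at hlt
    -- `‖x‖ = ‖ϖ‖^t` with `t ≤ 3`
    have hx0 : x ≠ 0 := norm_pos_iff.mp ((zpow_pos hρ0 _).trans hgt4)
    obtain ⟨t, ht⟩ := hϖ.2 (Units.mk0 x hx0)
    rw [Units.val_mk0] at ht
    rw [ht] at hgt4 hlt
    have ht3 : t < 4 := (zpow_lt_zpow_iff_right_of_lt_one₀ hρ0 hρ1).mp hgt4
    rw [← zpow_add₀ hρ0.ne'] at hlt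
    have h6 : (6 : ℤ) < t + t := (zpow_lt_zpow_iff_right_of_lt_one₀ hρ0 hρ1).mp hlt
    omega

/-- Squares lemma, contrapositive form used below: a unit square `u²` never has `‖u² − 1‖ = ‖ϖ‖⁷`.
[cite: NeukirchANT1999, Ch. II Prop. (5.5)] -/
theorem norm_sq_sub_one_ne_zpow_seven {ϖ : Kˣ} (hϖ : IsUniformizer ϖ) (he : absRamificationIdx 2 K = 4)
    (hprinc : ∀ u : K, ‖u‖ = 1 → IsPrincipal u) {u : K} (hu : ‖u‖ = 1) :
    ‖u ^ 2 - 1‖ ≠ ‖(ϖ : K)‖ ^ (7 : ℤ) := by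
  intro h
  have hρ0 : 0 < ‖(ϖ : K)‖ := norm_units_pos ϖ
  have h9 := norm_sq_sub_one_le_of_lt hϖ he hprinc hu
    (by rw [h]; exact zpow_lt_zpow_right_of_lt_one₀ hρ0 hϖ.1 (by norm_num))
  rw [h] at h9
  exact absurd h9 (not_le.mpr (zpow_lt_zpow_right_of_lt_one₀ hρ0 hϖ.1 (by norm_num)))

/-- Squares lemma, second instance: a unit square `u²` never has `‖u² − 1‖ = ‖ϖ‖⁸`.
[cite: NeukirchANT1999, Ch. II Prop. (5.5)] -/
theorem norm_sq_sub_one_ne_zpow_eight {ϖ : Kˣ} (hϖ : IsUniformizer ϖ) (he : absRamificationIdx 2 K = 4)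
    (hprinc : ∀ u : K, ‖u‖ = 1 → IsPrincipal u) {u : K} (hu : ‖u‖ = 1) :
    ‖u ^ 2 - 1‖ ≠ ‖(ϖ : K)‖ ^ (8 : ℤ) := by
  intro h
  have hρ0 : 0 < ‖(ϖ : K)‖ := norm_units_pos ϖ
  have h9 := norm_sq_sub_one_le_of_lt hϖ he hprinc hu
    (by rw [h]; exact zpow_lt_zpow_right_of_lt_one₀ hρ0 hϖ.1 (by norm_num))
  rw [h] at h9
  exact absurd h9 (not_le.mpr (zpow_lt_zpow_right_of_lt_one₀ hρ0 hϖ.1 (by norm_num)))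

/-! ## 3. If `log₂(𝒪_K^×) = 𝔪²`, deep principal units are `±` squares -/

/-- **`e = 4`, `f = 1`, `m = 1` and `log₂(𝒪_K^×) = {‖y‖ ≤ ‖ϖ‖²}` ⇒ every `w` with `‖1 − w‖ = ‖ϖ‖^a`, `a ≥ 6`,
is `u²` or `−u²` for some unit `u`**: `‖log₂ w‖ = ‖ϖ‖^a ≤ ‖2‖·‖ϖ‖²`, so `log₂ w = 2·log₂ u = log₂ u²` for a
unit `u`, and `w·u⁻²` is killed by `log₂`, hence a root of unity, hence `±1`. [cite: NeukirchANT1999, Ch. II Prop. (5.5)] -/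
theorem eq_sq_or_eq_neg_sq_of_logUnits_eq_closedBall_two {ϖ : Kˣ} (hϖ : IsUniformizer ϖ)
    (he : absRamificationIdx 2 K = 4) (hf : residueDegree 2 K = 1) (hm : torsionPExp 2 K = 1)
    (hΛ : logUnits K = closedBall (0 : K) (‖(ϖ : K)‖ ^ (2 : ℤ))) {w : K} {a : ℤ}
    (hw : ‖1 - w‖ = ‖(ϖ : K)‖ ^ a) (ha : 6 ≤ a) :
    ∃ u : K, ‖u‖ = 1 ∧ (w = u ^ 2 ∨ w = -u ^ 2) := by
  have hρ0 : 0 < ‖(ϖ : K)‖ := norm_units_pos ϖ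
  have hρ1 : ‖(ϖ : K)‖ < 1 := hϖ.1
  have h2 : ‖(2 : K)‖ = ‖(ϖ : K)‖ ^ (4 : ℤ) := by
    rw [norm_two_eq_zpow hϖ, he]; norm_num
  have h20 : (2 : K) ≠ 0 := norm_pos_iff.mp (by rw [h2]; exact zpow_pos hρ0 _)
  -- `w` is a principal unit with `‖log₂ w‖ = ‖ϖ‖^a`
  have hwP : IsPrincipal w := by
    show ‖1 - w‖ < 1
    rw [hw]
    exact zpow_lt_one₀ hρ0 hρ1 (by linarith)
  have hw1 : ‖w‖ = 1 := hwP.norm_eq_one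
  have hlogw : ‖unitLog w‖ = ‖(ϖ : K)‖ ^ a := by
    rw [unitLog_of_isPrincipal 2 hwP]
    exact norm_logSeries_of_deep hϖ hw (by rw [he]; push_cast; linarith)
  -- `log₂ w / 2 ∈ 𝔪² = log₂(𝒪^×)`
  set z : K := (2 : K)⁻¹ * unitLog w with hzdef
  have hz : z ∈ logUnits K := by
    rw [hΛ, mem_closedBall_zero_iff, hzdef, norm_mul, norm_inv, h2, hlogw, ← zpow_neg, ← zpow_add₀ hρ0.ne']
    exact zpow_le_zpow_right_of_le_one₀ hρ0 hρ1.le (by linarith)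
  obtain ⟨u, hu, huz⟩ := mem_logUnits_iff.mp hz
  refine ⟨u, hu, ?_⟩
  have hu0 : u ≠ 0 := norm_pos_iff.mp (by rw [hu]; exact one_pos)
  have hu2 : ‖u ^ 2‖ = 1 := by rw [norm_pow, hu, one_pow]
  have hu2i : ‖(u ^ 2)⁻¹‖ = 1 := by rw [norm_inv, hu2, inv_one]
  -- `log₂ (w · u⁻²) = 0`
  have hlog2 : unitLog (u ^ 2) = unitLog w := by
    rw [unitLog_pow 2 hu 2, huz, hzdef]
    push_cast
    rw [← mul_assoc, mul_inv_cancel₀ h20, one_mul]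
  set ζ : K := w * (u ^ 2)⁻¹ with hζdef
  have hζ1 : ‖ζ‖ = 1 := by rw [hζdef, norm_mul, hw1, hu2i, one_mul]
  have hζlog : unitLog ζ = 0 := by
    rw [hζdef, unitLog_mul 2 hw1 hu2i, unitLog_inv 2 hu2, hlog2, add_neg_cancel]
  obtain ⟨n, hn, hζn⟩ := (unitLog_eq_zero_iff 2 K hζ1).mp hζlog
  have hwζ : w = ζ * u ^ 2 := by
    rw [hζdef, inv_mul_cancel_right₀ (pow_ne_zero 2 hu0)]
  rcases eq_one_or_eq_neg_one_of_pow_eq_one hf hm hn hζn with h | h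
  · exact Or.inl (by rw [hwζ, h, one_mul])
  · exact Or.inr (by rw [hwζ, h, neg_one_mul])

/-! ## 4. `e = 4`, `f = 1`, `m = 1`: no ball is a `2^k · log₂(𝒪_K^×)` -/

/-- **THE LAST DYADIC TYPE.**  `p = 2`, `e = 4`, `f = 1`, `m = 1` (`√−1 ∉ K`) ⇒ `{‖y‖ ≤ ‖ϖ‖^j} ≠ 2^k · log₂(𝒪_K^×)`
for ALL `j`, `k`: the volume identity `m = f·(j − k·e − 1)` forces `j = 4k + 2`, i.e. `log₂(𝒪_K^×) = 𝔪²`; then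
`1 − ϖ⁷` and `1 − ϖ⁸` are both MINUS unit squares (`±` squares by §3, not squares by §2), and the product of the two
squares, `(1 − ϖ⁷)(1 − ϖ⁸) = 1 − ϖ⁷·(1 + ϖ − ϖ⁸)`, is a unit square at distance EXACTLY `‖ϖ‖⁷` from `1` — excluded
by §2. [cite: NeukirchANT1999, Ch. II Prop. (5.5), (5.7)] -/
theorem closedBall_ne_zpow_smul_logUnits_of_absRamificationIdx_eq_four_of_torsionPExp_eq_one {ϖ : Kˣ}
    (hϖ : IsUniformizer ϖ) (he : absRamificationIdx 2 K = 4) (hf : residueDegree 2 K = 1)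
    (hm : torsionPExp 2 K = 1) (j k : ℤ) :
    closedBall (0 : K) (‖(ϖ : K)‖ ^ j) ≠ ((2 : ℚ_[2]) ^ k) • logUnits K := by
  intro h
  have hρ0 : 0 < ‖(ϖ : K)‖ := norm_units_pos ϖ
  have hρ1 : ‖(ϖ : K)‖ < 1 := hϖ.1
  have hprinc : ∀ u : K, ‖u‖ = 1 → IsPrincipal u :=
    fun u hu ↦ WildDyadic.isPrincipal_of_residueDegree_eq_one hf hu
  have h' : closedBall (0 : K) (‖(ϖ : K)‖ ^ j) = (((2 : ℕ) : ℚ_[2]) ^ k) • logUnits K := by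
    simpa only [Nat.cast_ofNat] using h
  -- Step 1: `j = 4k + 2`
  have H := torsionPExp_eq_of_closedBall_eq_zpow_smul_logUnits 2 K hϖ h'
  rw [hm, hf, he] at H
  push_cast at H
  have hj : j = 4 * k + 2 := by linarith
  -- Step 2: `log₂(𝒪^×) = 𝔪²`
  have hΛ : logUnits K = closedBall (0 : K) (‖(ϖ : K)‖ ^ (2 : ℤ)) := by
    rw [(closedBall_eq_zpow_smul_iff 2 K _ k _).mp h', natCast_prime_eq_zpow 2 hϖ, ← zpow_mul,
      ← zpow_add₀ hρ0.ne', he, hj]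
    congr 2
    push_cast
    ring
  -- Step 3: the two deep units `1 − ϖ⁷`, `1 − ϖ⁸`
  obtain ⟨u₁, hu₁, h₁⟩ := eq_sq_or_eq_neg_sq_of_logUnits_eq_closedBall_two hϖ he hf hm hΛ
    (norm_one_sub_one_sub_pow (ϖ := ϖ) 7) (by norm_num)
  obtain ⟨u₂, hu₂, h₂⟩ := eq_sq_or_eq_neg_sq_of_logUnits_eq_closedBall_two hϖ he hf hm hΛ
    (norm_one_sub_one_sub_pow (ϖ := ϖ) 8) (by norm_num)
  have hn7 : ‖(1 - (ϖ : K) ^ 7) - 1‖ = ‖(ϖ : K)‖ ^ (7 : ℤ) := by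
    rw [sub_sub_cancel_left, norm_neg, norm_pow, ← zpow_natCast]; norm_num
  have hn8 : ‖(1 - (ϖ : K) ^ 8) - 1‖ = ‖(ϖ : K)‖ ^ (8 : ℤ) := by
    rw [sub_sub_cancel_left, norm_neg, norm_pow, ← zpow_natCast]; norm_num
  rcases h₁ with h₁ | h₁
  · -- `1 − ϖ⁷ = u₁²`: excluded by the squares lemma
    exact norm_sq_sub_one_ne_zpow_seven hϖ he hprinc hu₁ (by rw [← h₁, hn7])
  rcases h₂ with h₂ | h₂
  · -- `1 − ϖ⁸ = u₂²`: excluded by the squares lemma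
    exact norm_sq_sub_one_ne_zpow_eight hϖ he hprinc hu₂ (by rw [← h₂, hn8])
  -- both are minus squares: `(u₁u₂)² = (1 − ϖ⁷)(1 − ϖ⁸)` is at distance `‖ϖ‖⁷` from `1`
  have hu12 : ‖u₁ * u₂‖ = 1 := by rw [norm_mul, hu₁, hu₂, one_mul]
  refine norm_sq_sub_one_ne_zpow_seven hϖ he hprinc hu12 ?_
  have hprod : (u₁ * u₂) ^ 2 - 1 = -(ϖ : K) ^ 7 * (1 + (ϖ : K) * (1 - (ϖ : K) ^ 7)) := by
    have e₁ : u₁ ^ 2 = -(1 - (ϖ : K) ^ 7) := by rw [h₁, neg_neg]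
    have e₂ : u₂ ^ 2 = -(1 - (ϖ : K) ^ 8) := by rw [h₂, neg_neg]
    rw [mul_pow, e₁, e₂]
    ring
  have hone : ‖1 + (ϖ : K) * (1 - (ϖ : K) ^ 7)‖ = 1 := by
    have hP7 : IsPrincipal (1 - (ϖ : K) ^ 7) := isPrincipal_one_sub_pow hϖ (by norm_num)
    have hP : IsPrincipal (1 + (ϖ : K) * (1 - (ϖ : K) ^ 7)) := by
      show ‖1 - (1 + (ϖ : K) * (1 - (ϖ : K) ^ 7))‖ < 1
      rw [sub_add_cancel_left, norm_neg, norm_mul, hP7.norm_eq_one, mul_one]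
      exact hρ1
    exact hP.norm_eq_one
  rw [hprod, norm_mul, norm_neg, norm_pow, hone, mul_one, ← zpow_natCast]
  norm_num

/-! ## 5. The dyadic table, complete -/

/-- **`p = 2`, `e = 4` ⇒ `{‖y‖ ≤ ‖ϖ‖^j} ≠ 2^k · log₂(𝒪_K^×)` for all `j`, `k`** — every residue degree, every
`m` (`m ≥ 2`: abc-iut-w4-d017's `closedBall_ne_zpow_smul_logUnits_of_absRamificationIdx_eq_four`; `m = 1`, `f ≥ 2`:
`closedBall_ne_zpow_smul_logUnits_of_two_dvd`; `m = 1`, `f = 1`: §4). [cite: NeukirchANT1999, Ch. II Prop. (5.5), (5.7)] -/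
theorem closedBall_ne_zpow_smul_logUnits_of_absRamificationIdx_eq_four_all {ϖ : Kˣ} (hϖ : IsUniformizer ϖ)
    (he : absRamificationIdx 2 K = 4) (j k : ℤ) :
    closedBall (0 : K) (‖(ϖ : K)‖ ^ j) ≠ ((2 : ℚ_[2]) ^ k) • logUnits K := by
  by_cases hm : 2 ≤ torsionPExp 2 K
  · exact closedBall_ne_zpow_smul_logUnits_of_absRamificationIdx_eq_four hϖ he hm j k
  have hm1 : torsionPExp 2 K = 1 := by
    have := one_le_torsionPExp_of_two 2 K rfl
    omega
  by_cases hf : 2 ≤ residueDegree 2 K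
  · exact closedBall_ne_zpow_smul_logUnits_of_two_dvd hϖ (by rw [he]; norm_num) hf j k
  have hf1 : residueDegree 2 K = 1 := by
    have := residueDegree_pos 2 K
    omega
  exact closedBall_ne_zpow_smul_logUnits_of_absRamificationIdx_eq_four_of_torsionPExp_eq_one hϖ he hf1 hm1 j k

/-- **THE DYADIC TABLE, COMPLETE.**  At `p = 2` with `e ≥ 2`: unless `(e, f) = (2, 1)`, NO ball `{‖y‖ ≤ ‖ϖ‖^j}` is a
`2^k · log₂(𝒪_K^×)` (`e = 4`: the previous theorem; otherwise abc-iut-w4-d017's `closedBall_ne_zpow_smul_logUnits_dyadic`).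
The type `(e, f) = (2, 1)` is genuinely trichotomous (`UnitLogWildQuadraticDyadicCases`: `ℚ₂(√3)`-like fields have
`log₂(𝒪^×) = 𝔪²`, `ℚ₂(√−1)` has `𝔪³`, the others no ball); `e = 1` is abc-iut-w5-d216 (`f = 1`: every ball) /
abc-iut-w5-d180 (`f ≥ 2`: none). [cite: NeukirchANT1999, Ch. II Prop. (5.5), (5.7)] -/
theorem closedBall_ne_zpow_smul_logUnits_dyadic_complete {ϖ : Kˣ} (hϖ : IsUniformizer ϖ)
    (he2 : 2 ≤ absRamificationIdx 2 K) (hnot : ¬ (absRamificationIdx 2 K = 2 ∧ residueDegree 2 K = 1)) (j k : ℤ) :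
    closedBall (0 : K) (‖(ϖ : K)‖ ^ j) ≠ ((2 : ℚ_[2]) ^ k) • logUnits K := by
  by_cases he4 : absRamificationIdx 2 K = 4
  · exact closedBall_ne_zpow_smul_logUnits_of_absRamificationIdx_eq_four_all hϖ he4 j k
  · refine closedBall_ne_zpow_smul_logUnits_dyadic hϖ he2 ?_ j k
    rintro ⟨hf1, he | he⟩
    · exact hnot ⟨he, hf1⟩
    · exact he4 he

/-- Norm form of the complete table: `e ≥ 2`, `(e, f) ≠ (2, 1)`, `t ≠ 0` ⇒ `{‖y‖ ≤ ‖t‖} ≠ 2^k · log₂(𝒪_K^×)`.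
[cite: NeukirchANT1999, Ch. II Prop. (5.5), (5.7)] -/
theorem closedBall_norm_ne_zpow_smul_logUnits_dyadic_complete {ϖ : Kˣ} (hϖ : IsUniformizer ϖ)
    (he2 : 2 ≤ absRamificationIdx 2 K) (hnot : ¬ (absRamificationIdx 2 K = 2 ∧ residueDegree 2 K = 1))
    {t : K} (ht : t ≠ 0) (k : ℤ) : closedBall (0 : K) ‖t‖ ≠ ((2 : ℚ_[2]) ^ k) • logUnits K := by
  obtain ⟨j, hj⟩ := hϖ.2 (Units.mk0 t ht)
  rw [Units.val_mk0] at hj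
  rw [hj]
  exact closedBall_ne_zpow_smul_logUnits_dyadic_complete hϖ he2 hnot j k

/-- Uniformizer-free norm form (a uniformizer always exists in a proper `K`): `e ≥ 2`, `(e, f) ≠ (2, 1)`, `t ≠ 0` ⇒
`{‖y‖ ≤ ‖t‖} ≠ 2^k · log₂(𝒪_K^×)`. [cite: NeukirchANT1999, Ch. II Prop. (5.5), (5.7)] -/
theorem closedBall_norm_ne_zpow_smul_logUnits_dyadic_complete' (he2 : 2 ≤ absRamificationIdx 2 K)
    (hnot : ¬ (absRamificationIdx 2 K = 2 ∧ residueDegree 2 K = 1)) {t : K} (ht : t ≠ 0) (k : ℤ) :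
    closedBall (0 : K) ‖t‖ ≠ ((2 : ℚ_[2]) ^ k) • logUnits K := by
  obtain ⟨ϖ, hϖ⟩ := exists_isUniformizer (F := K)
  exact closedBall_norm_ne_zpow_smul_logUnits_dyadic_complete hϖ he2 hnot ht k

end DyadicNoFixedBall

end Literature.IUT.LogVolume

end
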